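import Mathlib.AlgebraicGeometry.EllipticCurve.VariableChange
import Mathlib.MeasureTheory.Integral.Bochner.Basic
import Mathlib.MeasureTheory.Measure.Haar.NormedSpace
import Mathlib.MeasureTheory.Group.Integral
import Mathlib.Analysis.SpecialFunctions.Pow.Real
import Mathlib.Analysis.SpecialFunctions.Elliptic.Weierstrass
import Mathlib.Topology.Algebra.Polynomial
import Mathlib.Analysis.Complex.Polynomial.Basic
import Mathlib.FieldTheory.Separable
import Mathlib.Analysis.SpecialFunctions.Integrability.Basic
import Mathlib.Analysis.SpecialFunctions.ImproperIntegrals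
import Mathlib.MeasureTheory.Integral.Asymptotics
import Mathlib.MeasureTheory.Function.SpecialFunctions.Basic
import HarnessLib

-- provenance: harness21/H21/H21/Prelude/TranscendEllArithS/RealPeriod.lean @ 76e3a6b (interim HEAD d8f2665); M5 mechanical rewrite
/-!
# The real period of a Weierstrass model over `ℝ`

Trunk `TranscendEllArithS`, concept C15 (`real_period`), used by the BSD family.

For a Weierstrass model `W : y² + a₁xy + a₃y = x³ + a₂x² + a₄x + a₆` over `ℝ` the *invariant
differential* is `ω = dx / (2y + a₁x + a₃)` and the *real period* is
`Ω(W) = ∫_{E(ℝ)} |ω|`.  Completing the square, `(2y + a₁x + a₃)² = ψ(x)` where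
`ψ(x) = 4x³ + b₂x² + 2b₄x + b₆` is Mathlib's `WeierstrassCurve.twoTorsionPolynomial`, and the
projection `(x, y) ↦ x` is `2 : 1` from `E(ℝ)` (minus 2-torsion) onto `{x | ψ(x) > 0}`. Hence
`Ω(W) = 2 ∫_{ψ > 0} dx / √ψ(x)`; this already includes the factor "number of connected components
of `E(ℝ)`" (`2` if `Δ > 0`, `1` if `Δ < 0`), i.e. `Ω = numRealComponents · Ω₀` where `Ω₀` is the
least positive real period of the period lattice of `ω`.

## Main definitions (namespace `WeierstrassCurve`, a deliberate dot-notation extension of Mathlib)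

* `WeierstrassCurve.twoTorsionSet W` : the open set `{x : ℝ | 0 < ψ(x)}`.
* `WeierstrassCurve.realPeriod W` : `Ω(W) = 2 ∫_{ψ > 0} (√ψ(x))⁻¹ dx`.
* `WeierstrassCurve.numRealComponents W` : `2` if `0 < Δ`, else `1`.

## Main statements (proofs `sorry` unless trivial)

* `measurableSet_twoTorsionSet` (proved), `integrableOn_inv_sqrt_twoTorsionPolynomial`,
  `realPeriod_pos`.
* `realPeriod_smul` : behaviour under Mathlib's `VariableChange`.  Mathlib's convention
  (`Mathlib.AlgebraicGeometry.EllipticCurve.VariableChange`) is `(X, Y) ↦ (u²X' + r, u³Y' + u²sX' + t)`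
  with `(C • W).aᵢ = u⁻ⁱ (…)`, so `2Y + a₁X + a₃ = u³ (2Y' + a₁'X' + a₃')`, `dX = u² dX'` and
  `ω = u⁻¹ ω'`, i.e. `ω' = u ω`.  Consequently `Ω(C • W) = |u| · Ω(W)` (consistent with
  `variableChange_Δ : Δ' = u⁻¹² Δ` and `Ω ∼ |Δ|^{-1/12}`).
* `realPeriod_eq_of_abs_u_eq_one` : invariance under changes with `u = ±1` (proved from the above).
* `realPeriod_smul_holds`, `realPeriod_eq_of_abs_u_eq_one_holds` : sorry-free discharges of the two
  named facts above (affine change of variables in the Lebesgue integral; end of file).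
* `integrableOn_inv_sqrt_twoTorsionPolynomial_holds`, `realPeriod_pos_holds` : sorry-free
  discharges of the integrability of `1/√ψ` on `{ψ > 0}` and of `0 < Ω(W)` for elliptic `W`
  (end of file): `Δ ≠ 0 ⇒ ψ` separable `⇒ 1/√ψ ≤ C |x − x₀|^{-1/2}` near every `x₀`, and
  `1/√ψ ≤ x^{-3/2}` for `x ≫ 0`, `= 0` for `x ≪ 0`; then the integral of a positive integrable
  function over a non-empty open set is positive.
* `exists_periodPair_realPeriod_eq` : uniformisation link with Mathlib's `PeriodPair`: there is a
  period lattice `Λ` with `g₂(Λ) = c₄/12`, `g₃(Λ) = c₆/216` (so that `X = ℘ − b₂/12`,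
  `2Y + a₁X + a₃ = ℘'`, `ω = dz`) and `Ω(W) = numRealComponents(W) · min {t > 0 | t ∈ Λ}`.

Mathlib has `WeierstrassCurve.twoTorsionPolynomial`, `VariableChange`, `PeriodPair`,
`PeriodPair.lattice`, `PeriodPair.g₂`, `PeriodPair.g₃` (all used); it has no real period
(grep `realPeriod|real period`: nothing).

## References

* J. H. Silverman, *The Arithmetic of Elliptic Curves*, 2nd ed., §III.1 (variable changes), §VI.5,
  and *Advanced Topics*, §V.2; C.16 in the BSD appendix.
* J. E. Cremona, *Algorithms for Modular Elliptic Curves*, 2nd ed., §3.7 (the period lattice and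
  `Ω = 2ω₁` resp. `ω₁` according to `Δ > 0` resp. `Δ < 0`).
* A. Wiles, *The Birch and Swinnerton-Dyer conjecture*, Clay Millennium Problem text (2006).
-/

noncomputable section

open scoped Classical
open MeasureTheory Polynomial

namespace WeierstrassCurve

variable (W : WeierstrassCurve ℝ)

/-- The set `{x : ℝ | 0 < ψ(x)}` where `ψ = 4x³ + b₂x² + 2b₄x + b₆ = (2y + a₁x + a₃)²` is the
2-torsion polynomial (`WeierstrassCurve.twoTorsionPolynomial`).  It is the image of
`E(ℝ) ∖ E[2]` under the `2 : 1` projection `(x, y) ↦ x`.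
(Cremona, *Algorithms for Modular Elliptic Curves*, §3.7.) [folklore] -/
def twoTorsionSet : Set ℝ :=
  {x | 0 < W.twoTorsionPolynomial.toPoly.eval x}

/-- Membership in the two-torsion set, by definition (Cremona, *Algorithms*, §3.7). [folklore] -/
lemma mem_twoTorsionSet_iff (x : ℝ) :
    x ∈ W.twoTorsionSet ↔ 0 < W.twoTorsionPolynomial.toPoly.eval x :=
  Iff.rfl

/-- The two-torsion set `{x | 0 < ψ(x)}` is open (preimage of `(0, ∞)` under a polynomial map).
(Cremona, *Algorithms*, §3.7.) [folklore] -/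
theorem isOpen_twoTorsionSet : IsOpen W.twoTorsionSet :=
  isOpen_lt continuous_const (Polynomial.continuous _)

/-- The two-torsion set `{x | 0 < ψ(x)}` is Lebesgue measurable (it is open).
(Cremona, *Algorithms*, §3.7.) [folklore] -/
theorem measurableSet_twoTorsionSet : MeasurableSet W.twoTorsionSet :=
  W.isOpen_twoTorsionSet.measurableSet

/-- The **real period** `Ω(W) = ∫_{E(ℝ)} |dx / (2y + a₁x + a₃)| = 2 ∫_{ψ > 0} dx / √ψ(x)` of a
Weierstrass model over `ℝ`, where `ψ = twoTorsionPolynomial`.  The factor `2` accounts for the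
`2 : 1` projection to the `x`-line; the integral over *all* of `{ψ > 0}` accounts for both real
components when `Δ > 0`, so `Ω = numRealComponents · Ω₀` with `Ω₀` the least positive real period
(see `exists_periodPair_realPeriod_eq`).  For a singular model the integrand need not be
integrable and the Bochner integral returns the junk value `0`.
(Silverman, AEC C.16; Cremona, *Algorithms*, §3.7; Wiles, Clay BSD text.) [folklore] -/
def realPeriod : ℝ :=
  2 * ∫ x in W.twoTorsionSet, (Real.sqrt (W.twoTorsionPolynomial.toPoly.eval x))⁻¹

/-- The number of connected components of `E(ℝ)` for a Weierstrass model over `ℝ`: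
`2` if `Δ > 0` (ψ has three real roots), `1` otherwise (`Δ < 0`: one real root; for singular
models, `Δ = 0`, the value `1` is a harmless junk value).
(Silverman, AEC, Ex. V.5.9 / Cremona, *Algorithms*, §3.7.) [folklore] -/
def numRealComponents : ℕ :=
  if 0 < W.Δ then 2 else 1

/-- `Δ > 0`: two real components (Cremona, *Algorithms*, §3.7). [folklore] -/
lemma numRealComponents_of_Δ_pos (h : 0 < W.Δ) : W.numRealComponents = 2 := if_pos h

/-- `Δ ≤ 0`: one real component (Cremona, *Algorithms*, §3.7). [folklore] -/
lemma numRealComponents_of_Δ_nonpos (h : W.Δ ≤ 0) : W.numRealComponents = 1 :=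
  if_neg (not_lt.mpr h)

/-- The number of real components is `1` or `2`, in particular positive
(Cremona, *Algorithms*, §3.7). [folklore] -/
lemma numRealComponents_pos : 0 < W.numRealComponents := by
  unfold numRealComponents; split_ifs <;> norm_num

/-- For an elliptic curve over `ℝ` (`Δ ≠ 0`, so `ψ` has simple roots) the function
`x ↦ 1/√ψ(x)` is integrable on `{ψ > 0}`: near a simple root `e` it behaves like `|x − e|^{-1/2}`
and at `+∞` like `x^{-3/2} / 2`.
(Cremona, *Algorithms*, §3.7; Silverman, AEC, §VI.1.) [cite: CremonaAlgorithms1997, §3.7] -/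
def integrableOn_inv_sqrt_twoTorsionPolynomial : Prop :=
  ∀ [W.IsElliptic],
    IntegrableOn (fun x ↦ (Real.sqrt (W.twoTorsionPolynomial.toPoly.eval x))⁻¹)
      W.twoTorsionSet

/-- The real period of an elliptic curve over `ℝ` is positive.
(Silverman, AEC C.16; Cremona, *Algorithms*, §3.7.) [cite: CremonaAlgorithms1997, §3.7; Silverman AEC C.16] -/
def realPeriod_pos : Prop :=
  ∀ [W.IsElliptic],
    0 < W.realPeriod

/-- Behaviour of the real period under an admissible change of variables.  With Mathlib's
convention `(X, Y) ↦ (u²X' + r, u³Y' + u²sX' + t)` (so `(C • W).aᵢ = u⁻ⁱ(…)`), one has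
`2Y + a₁X + a₃ = u³(2Y' + a₁'X' + a₃')` and `dX = u² dX'`, hence the invariant differentials
satisfy `ω' = u · ω` and `Ω(C • W) = |u| · Ω(W)`.  Directly on the definition:
`ψ'(x') = u⁻⁶ ψ(u²x' + r)`, so `∫ dx'/√ψ' = |u|³ · u⁻² ∫ dx/√ψ = |u| ∫ dx/√ψ` (this holds for every
model, elliptic or not, by the change-of-variables formula for the Lebesgue integral).
(Silverman, AEC, §III.1, Table 3.1: `ω' = u ω`; Silverman's primed/unprimed convention
`x = u²x' + r` matches Mathlib's.) [cite: SilvermanAEC2009, §III.1 Table 3.1] -/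
def realPeriod_smul : Prop :=
  ∀ (C : VariableChange ℝ),
    (C • W).realPeriod = |(C.u : ℝ)| * W.realPeriod

/-- The real period is invariant under changes of variables with `u = ±1`, in particular under
the integral changes of variables (`u ∈ ℤˣ`) relating two globally minimal models over `ℚ`.
(Silverman, AEC, §VII.1 and C.16.) [folklore] -/
def realPeriod_eq_of_abs_u_eq_one : Prop :=
  ∀ (C : VariableChange ℝ) (h : |(C.u : ℝ)| = 1),
    (C • W).realPeriod = W.realPeriod

/- interim proof relied on results that are now named facts (D-0014); demoted to a fact by the M5 import, proof preserved:
:= by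
  rw [realPeriod_smul, h, one_mul]
-/

/-- **Uniformisation link.**  For an elliptic curve `W` over `ℝ` there is a period lattice
`Λ = ℤω₁ + ℤω₂ ⊂ ℂ` (a Mathlib `PeriodPair`) with `g₂(Λ) = c₄/12` and `g₃(Λ) = c₆/216`, so that
`z ↦ (℘(z) − b₂/12, (℘'(z) − a₁x − a₃)/2)` is an isomorphism `ℂ/Λ ≃ E(ℂ)` pulling `ω` back to
`dz` (note `ψ(℘ − b₂/12) = 4℘³ − g₂℘ − g₃ = ℘'²`); `Λ` is stable under complex conjugation, its real
points `Λ ∩ ℝ = ℤ Ω₀` for a least positive real period `Ω₀`, and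
`Ω(W) = numRealComponents(W) · Ω₀`.
(Silverman, AEC, VI.5.1 and C.16; Cremona, *Algorithms*, §3.7; Wiles, Clay BSD text.) [cite: SilvermanAEC2009, VI.5.1 and C.16; Cremona §3.7] -/
def exists_periodPair_realPeriod_eq : Prop :=
  ∀ [W.IsElliptic],
    ∃ L : PeriodPair, L.g₂ = ((W.c₄ / 12 : ℝ) : ℂ) ∧ L.g₃ = ((W.c₆ / 216 : ℝ) : ℂ) ∧
      W.realPeriod = W.numRealComponents * sInf {t : ℝ | 0 < t ∧ (t : ℂ) ∈ L.lattice}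


/-! ### Discharges (D-0014 append protocol) -/

/-- Transformation of the 2-torsion polynomial `ψ = 4x³ + b₂x² + 2b₄x + b₆` under Mathlib's
change of variables `x = u²x' + r`: `ψ_{C • W}(x') = u⁻⁶ · ψ_W(u²x' + r)`.  This is the identity
`(2y' + a₁'x' + a₃')² = u⁻⁶ (2y + a₁x + a₃)²` read off from Silverman's Table 3.1
(`u²b₂' = b₂ + 12r`, `u⁴b₄' = b₄ + rb₂ + 6r²`, `u⁶b₆' = b₆ + 2rb₄ + r²b₂ + 4r³`).
[cite: SilvermanAEC2009, §III.1 Table 3.1 (p. 45)] -/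
theorem eval_twoTorsionPolynomial_variableChange (C : VariableChange ℝ) (x : ℝ) :
    ((C • W).twoTorsionPolynomial.toPoly.eval x) =
      (C.u : ℝ)⁻¹ ^ 6 * W.twoTorsionPolynomial.toPoly.eval ((C.u : ℝ) ^ 2 * x + C.r) := by
  have hu : (C.u : ℝ) ≠ 0 := C.u.ne_zero
  simp only [twoTorsionPolynomial, Cubic.toPoly, eval_add, eval_mul, eval_C, eval_pow, eval_X,
    variableChange_b₂, variableChange_b₄, variableChange_b₆, Units.val_inv_eq_inv_val]
  field_simp
  ring

/-- The two-torsion set transforms as the preimage under `x' ↦ u²x' + r`: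
`x' ∈ twoTorsionSet (C • W) ↔ u²x' + r ∈ twoTorsionSet W` (since `u⁻⁶ > 0`).
[cite: SilvermanAEC2009, §III.1 Table 3.1 (p. 45)] -/
theorem mem_twoTorsionSet_variableChange_iff (C : VariableChange ℝ) (x : ℝ) :
    x ∈ (C • W).twoTorsionSet ↔ (C.u : ℝ) ^ 2 * x + C.r ∈ W.twoTorsionSet := by
  have hu : (C.u : ℝ) ≠ 0 := C.u.ne_zero
  have h6 : (0 : ℝ) < (C.u : ℝ)⁻¹ ^ 6 := by positivity
  rw [mem_twoTorsionSet_iff, mem_twoTorsionSet_iff, eval_twoTorsionPolynomial_variableChange,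
    mul_pos_iff_of_pos_left h6]

/-- **Discharge of `realPeriod_smul`.**  `Ω(C • W) = |u| · Ω(W)` for every Weierstrass model over `ℝ`
and every admissible change of variables `x = u²x' + r`, `y = u³y' + u²sx' + t` (Silverman's
`u⁻¹ω' = ω`, Table 3.1).  Proof directly on the definition `Ω = 2 ∫_{ψ > 0} dx/√ψ`: by
`eval_twoTorsionPolynomial_variableChange`, `1/√ψ'(x') = |u|³ /√ψ(u²x' + r)` and
`{ψ' > 0} = (x' ↦ u²x' + r)⁻¹' {ψ > 0}`, and the affine substitution `x = u²x' + r` in the Lebesgue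
(Bochner) integral over `ℝ` contributes `|u²|⁻¹` (`MeasureTheory.Measure.integral_comp_mul_left`,
`MeasureTheory.integral_add_right_eq_self`); no integrability hypothesis is needed.
[cite: SilvermanAEC2009, §III.1 Table 3.1 (p. 45)] -/
theorem realPeriod_smul_holds : W.realPeriod_smul := by
  intro C
  have hu : (C.u : ℝ) ≠ 0 := C.u.ne_zero
  set u : ℝ := (C.u : ℝ) with hu_def
  set f : ℝ → ℝ := fun x ↦ (Real.sqrt (W.twoTorsionPolynomial.toPoly.eval x))⁻¹ with hf
  have h6 : (0 : ℝ) < u⁻¹ ^ 6 := by positivity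
  have hsqrt : Real.sqrt (u⁻¹ ^ 6) = |u|⁻¹ ^ 3 := by
    rw [show u⁻¹ ^ 6 = (|u|⁻¹ ^ 3) ^ 2 by
      rw [← pow_mul, ← abs_inv, Even.pow_abs ⟨3, rfl⟩ (u⁻¹)]]
    exact Real.sqrt_sq (by positivity)
  -- pointwise identity of the integrands (extended by zero)
  have key : (C • W).twoTorsionSet.indicator
      (fun x ↦ (Real.sqrt ((C • W).twoTorsionPolynomial.toPoly.eval x))⁻¹) =
      fun x ↦ |u| ^ 3 * W.twoTorsionSet.indicator f (u ^ 2 * x + C.r) := by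
    funext x
    by_cases hx : u ^ 2 * x + C.r ∈ W.twoTorsionSet
    · rw [Set.indicator_of_mem ((W.mem_twoTorsionSet_variableChange_iff C x).mpr hx),
        Set.indicator_of_mem hx, eval_twoTorsionPolynomial_variableChange, hf]
      simp only
      rw [Real.sqrt_mul h6.le, mul_inv, hsqrt, inv_pow, inv_inv]
    · rw [Set.indicator_of_notMem (mt (W.mem_twoTorsionSet_variableChange_iff C x).mp hx),
        Set.indicator_of_notMem hx, mul_zero]
  have hsub : ∫ x, W.twoTorsionSet.indicator f (u ^ 2 * x + C.r) =
      |(u ^ 2)⁻¹| * ∫ x, W.twoTorsionSet.indicator f x := by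
    have h1 := Measure.integral_comp_mul_left
      (fun y ↦ W.twoTorsionSet.indicator f (y + C.r)) (u ^ 2)
    simp only [smul_eq_mul] at h1
    rw [h1, integral_add_right_eq_self (fun y ↦ W.twoTorsionSet.indicator f y) C.r]
  change 2 * ∫ x in (C • W).twoTorsionSet, _ = |u| * (2 * ∫ x in W.twoTorsionSet, f x)
  rw [← integral_indicator (C • W).measurableSet_twoTorsionSet,
    ← integral_indicator W.measurableSet_twoTorsionSet, key, integral_const_mul, hsub,
    abs_inv, abs_pow]
  have hau : |u| ≠ 0 := abs_ne_zero.mpr hu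
  field_simp

/-- **Discharge of `realPeriod_eq_of_abs_u_eq_one`** from `realPeriod_smul_holds`: changes of
variables with `|u| = 1` preserve the real period.
[cite: SilvermanAEC2009, §III.1 Table 3.1 (p. 45) and §VII.1] -/
theorem realPeriod_eq_of_abs_u_eq_one_holds : W.realPeriod_eq_of_abs_u_eq_one := by
  intro C h
  rw [W.realPeriod_smul_holds C, h, one_mul]


/-! ### Discharges of `integrableOn_inv_sqrt_twoTorsionPolynomial` and `realPeriod_pos`

Source check (Cremona, *Algorithms for Modular Elliptic Curves*, §3.7 "The period lattice",
eq. (3.7.1)): for `E/ℝ` written as `(y + (a₁x + a₃)/2)² = x³ + (b₂/4)x² + (b₄/2)x + b₆/4`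
(i.e. `ψ/4`), `λ₁ = π / AGM(√(e₃ − e₁), √(e₃ − e₂))` is "a positive real period" both for `Δ > 0`
(three real roots `e₃ > e₂ > e₁`, rectangular lattice) and for `Δ < 0` (`λ₁ = π / AGM(|z|, s)`,
"also real and positive"); Ch. I and Table 4: `Ω = 2λ₁` resp. `λ₁` according as the lattice is
rectangular or not.  Hence `Ω > 0`; the named fact `realPeriod_pos` is faithful.  The discharge
below is carried out directly on the vendored definition `Ω(W) = 2 ∫_{ψ>0} dx/√ψ(x)`:
the integrand is integrable (the analytic content, `integrableOn_inv_sqrt_twoTorsionPolynomial`)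
and positive on the non-empty open set `{ψ > 0}`. -/

section RealPeriodPos

open scoped Topology
open Set Filter Asymptotics

/-- Explicit form of the 2-torsion polynomial: `ψ(x) = 4x³ + b₂x² + 2b₄x + b₆`
(Mathlib's `twoTorsionPolynomial = ⟨4, b₂, 2b₄, b₆⟩`). [cite: CremonaAlgorithms1997, §3.7 (3.7.1)] -/
lemma eval_twoTorsionPolynomial (x : ℝ) :
    W.twoTorsionPolynomial.toPoly.eval x = 4 * x ^ 3 + W.b₂ * x ^ 2 + 2 * W.b₄ * x + W.b₆ := by
  simp only [twoTorsionPolynomial, Cubic.toPoly, eval_add, eval_mul, eval_C, eval_pow, eval_X]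

/-- `ψ ≠ 0` (leading coefficient `4`). [folklore] -/
lemma twoTorsionPolynomial_toPoly_ne_zero : W.twoTorsionPolynomial.toPoly ≠ 0 :=
  Cubic.ne_zero_of_a_ne_zero (by norm_num [twoTorsionPolynomial])

/-- For an elliptic curve over `ℝ` the 2-torsion polynomial `ψ` is separable (has simple roots):
`disc ψ = 16Δ ≠ 0` (Mathlib `twoTorsionPolynomial_discr`), so over `ℂ` the three roots
`e₁, e₂, e₃` are distinct (`Cubic.discr_ne_zero_iff_roots_nodup`), i.e. `ψ` is separable over `ℂ`
and hence over `ℝ`.  (Cremona §3.7: `ψ/4 = (x − e₁)(x − e₂)(x − e₃)` with the `eᵢ` distinct.)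
[cite: CremonaAlgorithms1997, §3.7 (3.7.1)] -/
theorem separable_twoTorsionPolynomial [W.IsElliptic] :
    W.twoTorsionPolynomial.toPoly.Separable := by
  have ha : W.twoTorsionPolynomial.a ≠ 0 := by norm_num [twoTorsionPolynomial]
  have hdisc : W.twoTorsionPolynomial.discr ≠ 0 :=
    W.twoTorsionPolynomial_discr_ne_zero_of_isElliptic (isUnit_iff_ne_zero.mpr two_ne_zero)
  have hsplit : (W.twoTorsionPolynomial.toPoly.map (algebraMap ℝ ℂ)).Splits :=
    IsAlgClosed.splits _
  have hnodup := (Cubic.discr_ne_zero_iff_roots_nodup ha hsplit).mp hdisc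
  rw [Cubic.map_roots] at hnodup
  have hne : W.twoTorsionPolynomial.toPoly.map (algebraMap ℝ ℂ) ≠ 0 :=
    Polynomial.map_ne_zero W.twoTorsionPolynomial_toPoly_ne_zero
  exact (separable_map _).mp ((nodup_roots_iff_of_splits hne hsplit).mp hnodup)

/-- **Local estimate.**  For an elliptic curve over `ℝ` and any `x₀ ∈ ℝ` there are `δ > 0` and `C`
with `1/√ψ(x) ≤ C / √|x − x₀|` for `0 < |x − x₀| < δ` (where `1/√ψ := 0` when `ψ ≤ 0`).
Proof: `ψ = (X − x₀)^m · q` with `m = rootMultiplicity x₀ ψ ≤ 1` (separability) and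
`q(x₀) ≠ 0`, so `|ψ(x)| ≥ c |x − x₀|` near `x₀` with `c = |q(x₀)|/2`.  This is the standard
"`|x − e|^{-1/2}` singularity at a simple root `e`" of the period integral `∫ dx/√ψ`.
[cite: CremonaAlgorithms1997, §3.7 (3.7.1)] -/
theorem exists_inv_sqrt_twoTorsionPolynomial_le [W.IsElliptic] (x₀ : ℝ) :
    ∃ δ > 0, ∃ C : ℝ, ∀ x, |x - x₀| < δ → x ≠ x₀ →
      (Real.sqrt (W.twoTorsionPolynomial.toPoly.eval x))⁻¹ ≤ C * (Real.sqrt |x - x₀|)⁻¹ := by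
  set p := W.twoTorsionPolynomial.toPoly with hp_def
  have hp0 : p ≠ 0 := W.twoTorsionPolynomial_toPoly_ne_zero
  have key : ∃ (m : ℕ) (q : ℝ[X]), m ≤ 1 ∧ q.eval x₀ ≠ 0 ∧
      ∀ x, p.eval x = (x - x₀) ^ m * q.eval x :=
    ⟨rootMultiplicity x₀ p, p /ₘ (X - C x₀) ^ rootMultiplicity x₀ p,
      rootMultiplicity_le_one_of_separable W.separable_twoTorsionPolynomial x₀,
      eval_divByMonic_pow_rootMultiplicity_ne_zero x₀ hp0, fun x => by
        conv_lhs => rw [← pow_mul_divByMonic_rootMultiplicity_eq p x₀]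
        simp only [eval_mul, eval_pow, eval_sub, eval_X, eval_C]⟩
  obtain ⟨m, q, hm, hq0, heval⟩ := key
  set c := |q.eval x₀| / 2 with hc_def
  have hq0' : 0 < |q.eval x₀| := abs_pos.mpr hq0
  have hc : 0 < c := by positivity
  have hev : ∀ᶠ x in 𝓝 x₀, c < |q.eval x| :=
    ((continuous_abs.comp q.continuous).tendsto x₀).eventually_const_lt (by
      show c < |q.eval x₀|
      rw [hc_def]; linarith)
  obtain ⟨δ₁, hδ₁, hball⟩ := Metric.eventually_nhds_iff.mp hev
  refine ⟨min δ₁ 1, lt_min hδ₁ one_pos, (Real.sqrt c)⁻¹, fun x hx hxx₀ => ?_⟩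
  have hx₁ : |x - x₀| < δ₁ := hx.trans_le (min_le_left _ _)
  have hx1 : |x - x₀| < 1 := hx.trans_le (min_le_right _ _)
  have hqx : c < |q.eval x| := hball (by rwa [Real.dist_eq])
  have habs : 0 < |x - x₀| := abs_pos.mpr (sub_ne_zero.mpr hxx₀)
  have hlow : c * |x - x₀| ≤ |p.eval x| := by
    rw [heval, abs_mul, abs_pow]
    have h1 : |x - x₀| ≤ |x - x₀| ^ m := by
      rcases Nat.le_one_iff_eq_zero_or_eq_one.mp hm with h | h
      · rw [h, pow_zero]; exact hx1.le
      · rw [h, pow_one]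
    calc c * |x - x₀| = |x - x₀| * c := mul_comm _ _
      _ ≤ |x - x₀| ^ m * |q.eval x| :=
          mul_le_mul h1 hqx.le hc.le (pow_nonneg (abs_nonneg _) _)
  have hpos : 0 < Real.sqrt (c * |x - x₀|) := Real.sqrt_pos.mpr (mul_pos hc habs)
  rcases le_or_gt (p.eval x) 0 with hpx | hpx
  · rw [Real.sqrt_eq_zero'.mpr hpx, inv_zero]
    exact mul_nonneg (inv_nonneg.mpr (Real.sqrt_nonneg _)) (inv_nonneg.mpr (Real.sqrt_nonneg _))
  · rw [abs_of_pos hpx] at hlow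
    calc (Real.sqrt (p.eval x))⁻¹ ≤ (Real.sqrt (c * |x - x₀|))⁻¹ :=
          inv_anti₀ hpos (Real.sqrt_le_sqrt hlow)
      _ = (Real.sqrt c)⁻¹ * (Real.sqrt |x - x₀|)⁻¹ := by
          rw [Real.sqrt_mul hc.le, mul_inv]

/-- The model singularity `x ↦ 1/√|x − x₀| = |x − x₀|^{-1/2}` is Lebesgue integrable on
`[x₀ − 1, x₀ + 1]` (from Mathlib's `intervalIntegrable_rpow'` with exponent `−1/2 > −1`,
translated and reflected). [folklore] -/
lemma integrableOn_inv_sqrt_abs_sub (x₀ : ℝ) :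
    IntegrableOn (fun x : ℝ => (Real.sqrt |x - x₀|)⁻¹) (Icc (x₀ - 1) (x₀ + 1)) := by
  have hr : (-1 : ℝ) < -(1 / 2) := by norm_num
  have h0 : IntervalIntegrable (fun t : ℝ => t ^ (-(1 / 2) : ℝ)) volume 0 1 :=
    intervalIntegral.intervalIntegrable_rpow' hr
  have hconv : ∀ t : ℝ, 0 ≤ t → t ^ (-(1 / 2) : ℝ) = (Real.sqrt t)⁻¹ := fun t ht => by
    rw [Real.rpow_neg ht, Real.sqrt_eq_rpow]
  have h1 : IntegrableOn (fun x : ℝ => (Real.sqrt |x - x₀|)⁻¹) (Ioc x₀ (x₀ + 1)) := by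
    have h := h0.comp_sub_right x₀
    rw [zero_add, add_comm (1 : ℝ) x₀,
      intervalIntegrable_iff_integrableOn_Ioc_of_le (by linarith)] at h
    refine h.congr_fun (fun x hx => ?_) measurableSet_Ioc
    have hx' : 0 < x - x₀ := by linarith [hx.1]
    simp only
    rw [hconv _ hx'.le, abs_of_pos hx']
  have h2 : IntegrableOn (fun x : ℝ => (Real.sqrt |x - x₀|)⁻¹) (Ioc (x₀ - 1) x₀) := by
    have h := (h0.comp_sub_left x₀).symm
    rw [sub_zero, intervalIntegrable_iff_integrableOn_Ioc_of_le (by linarith)] at h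
    refine h.congr_fun (fun x hx => ?_) measurableSet_Ioc
    have hx' : 0 ≤ x₀ - x := by linarith [hx.2]
    simp only
    rw [hconv _ hx', abs_sub_comm, abs_of_nonneg hx']
  have h3 := h2.union h1
  rw [Ioc_union_Ioc_eq_Ioc (by linarith) (by linarith)] at h3
  exact (integrableOn_Icc_iff_integrableOn_Ioc (by finiteness)).mpr h3

/-- **Growth of `ψ` at `±∞`.**  With `R = 1 + |b₂| + |2b₄| + |b₆|`: `ψ(x) ≥ x³` for `x ≥ R` and
`ψ(x) ≤ 0` for `x ≤ −R` (the cubic `4x³ + …` dominates).  So `{ψ > 0} ∋ R` is non-empty and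
bounded below, and `1/√ψ ≤ x^{-3/2}` on `[R, ∞)`. [folklore] -/
lemma twoTorsionPolynomial_bounds :
    ∃ R > 0, (∀ x, R ≤ x → x ^ 3 ≤ W.twoTorsionPolynomial.toPoly.eval x) ∧
      (∀ x, x ≤ -R → W.twoTorsionPolynomial.toPoly.eval x ≤ 0) := by
  refine ⟨|W.b₂| + |2 * W.b₄| + |W.b₆| + 1, by positivity, fun x hx => ?_, fun x hx => ?_⟩
  · rw [eval_twoTorsionPolynomial]
    have hx1 : 1 ≤ x := by linarith [abs_nonneg W.b₂, abs_nonneg (2 * W.b₄), abs_nonneg W.b₆]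
    have hx0 : 0 ≤ x := by linarith
    have hxx : x ≤ x ^ 2 := by nlinarith
    have h2 : -(|W.b₂| * x ^ 2) ≤ W.b₂ * x ^ 2 := by
      rw [← neg_mul]; exact mul_le_mul_of_nonneg_right (neg_abs_le _) (by positivity)
    have h4 : -(|2 * W.b₄| * x ^ 2) ≤ 2 * W.b₄ * x := by
      have h4a : -(|2 * W.b₄| * x) ≤ 2 * W.b₄ * x := by
        rw [← neg_mul]; exact mul_le_mul_of_nonneg_right (neg_abs_le _) hx0
      have h4b : |2 * W.b₄| * x ≤ |2 * W.b₄| * x ^ 2 :=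
        mul_le_mul_of_nonneg_left hxx (abs_nonneg _)
      linarith
    have h6 : -(|W.b₆| * x ^ 2) ≤ W.b₆ := by
      have : |W.b₆| ≤ |W.b₆| * x ^ 2 := le_mul_of_one_le_right (abs_nonneg _) (by nlinarith)
      linarith [neg_abs_le W.b₆]
    have hMx : (|W.b₂| + |2 * W.b₄| + |W.b₆|) * x ^ 2 ≤ x ^ 3 := by
      have hM : |W.b₂| + |2 * W.b₄| + |W.b₆| ≤ x := by linarith
      have : (|W.b₂| + |2 * W.b₄| + |W.b₆|) * x ^ 2 ≤ x * x ^ 2 :=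
        mul_le_mul_of_nonneg_right hM (by positivity)
      linarith [show x * x ^ 2 = x ^ 3 by ring]
    have hx3 : 0 ≤ x ^ 3 := by positivity
    linarith
  · rw [eval_twoTorsionPolynomial]
    have hx1 : 1 ≤ -x := by linarith [abs_nonneg W.b₂, abs_nonneg (2 * W.b₄), abs_nonneg W.b₆]
    have hx0 : x ≤ 0 := by linarith
    have hxx : -x ≤ x ^ 2 := by nlinarith
    have h2 : W.b₂ * x ^ 2 ≤ |W.b₂| * x ^ 2 :=
      mul_le_mul_of_nonneg_right (le_abs_self _) (by positivity)
    have h4 : 2 * W.b₄ * x ≤ |2 * W.b₄| * x ^ 2 := by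
      have h4a : 2 * W.b₄ * x ≤ |2 * W.b₄| * (-x) := by
        calc 2 * W.b₄ * x ≤ |2 * W.b₄ * x| := le_abs_self _
          _ = |2 * W.b₄| * (-x) := by rw [abs_mul, abs_of_nonpos hx0]
      have h4b : |2 * W.b₄| * (-x) ≤ |2 * W.b₄| * x ^ 2 :=
        mul_le_mul_of_nonneg_left hxx (abs_nonneg _)
      linarith
    have h6 : W.b₆ ≤ |W.b₆| * x ^ 2 := by
      have : |W.b₆| ≤ |W.b₆| * x ^ 2 := le_mul_of_one_le_right (abs_nonneg _) (by nlinarith)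
      linarith [le_abs_self W.b₆]
    have hMx : (|W.b₂| + |2 * W.b₄| + |W.b₆|) * x ^ 2 ≤ -x ^ 3 := by
      have hM : |W.b₂| + |2 * W.b₄| + |W.b₆| ≤ -x := by linarith
      have : (|W.b₂| + |2 * W.b₄| + |W.b₆|) * x ^ 2 ≤ (-x) * x ^ 2 :=
        mul_le_mul_of_nonneg_right hM (by positivity)
      linarith [show (-x) * x ^ 2 = -x ^ 3 by ring]
    have hx3 : x ^ 3 ≤ 0 := by nlinarith [sq_nonneg x]
    linarith

/-- The two-torsion set `{ψ > 0}` is non-empty (it contains every sufficiently large `x`).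
[folklore] -/
theorem twoTorsionSet_nonempty : W.twoTorsionSet.Nonempty := by
  obtain ⟨R, hR, htop, -⟩ := W.twoTorsionPolynomial_bounds
  exact ⟨R, (pow_pos hR 3).trans_le (htop R le_rfl)⟩

/-- **Integrability of the period integrand** (instance form of the named fact
`integrableOn_inv_sqrt_twoTorsionPolynomial`): for an elliptic curve over `ℝ`, `x ↦ 1/√ψ(x)` is
integrable on `{ψ > 0}` — in fact on all of `ℝ`, being `0` off `{ψ > 0}`.  Assembled from local
integrability at every point (`exists_inv_sqrt_twoTorsionPolynomial_le` +
`integrableOn_inv_sqrt_abs_sub`, singularities `|x − eᵢ|^{-1/2}` at the simple real roots) and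
the tails `1/√ψ ≤ x^{-3/2}` at `+∞`, `1/√ψ = 0` at `−∞` (`twoTorsionPolynomial_bounds`), via
`LocallyIntegrable.integrable_of_isBigO_atBot_atTop`.  This is the convergence of the real period
integral `∫ dx/√ψ` of Cremona §3.7 / Silverman VI.1.
[cite: CremonaAlgorithms1997, §3.7 (3.7.1)] -/
theorem integrableOn_inv_sqrt_twoTorsionPolynomial' [W.IsElliptic] :
    IntegrableOn (fun x ↦ (Real.sqrt (W.twoTorsionPolynomial.toPoly.eval x))⁻¹)
      W.twoTorsionSet := by
  set p := W.twoTorsionPolynomial.toPoly with hp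
  set f : ℝ → ℝ := fun x ↦ (Real.sqrt (p.eval x))⁻¹ with hf
  have hf_meas : Measurable f := (p.continuous.measurable.sqrt).inv
  have hf_nn : ∀ x, 0 ≤ f x := fun x => inv_nonneg.mpr (Real.sqrt_nonneg _)
  have hf_norm : ∀ x, ‖f x‖ = f x := fun x => Real.norm_of_nonneg (hf_nn x)
  -- local integrability at every point `x₀`
  have hloc : LocallyIntegrable f := by
    intro x₀
    obtain ⟨δ, hδ, C, hC⟩ := W.exists_inv_sqrt_twoTorsionPolynomial_le x₀
    refine ⟨Metric.ball x₀ (min δ 1), Metric.ball_mem_nhds _ (lt_min hδ one_pos), ?_⟩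
    have hsub : Metric.ball x₀ (min δ 1) ⊆ Icc (x₀ - 1) (x₀ + 1) := by
      rw [Real.ball_eq_Ioo]
      exact Ioo_subset_Icc_self.trans
        (Icc_subset_Icc (by linarith [min_le_right δ 1]) (by linarith [min_le_right δ 1]))
    have hg : IntegrableOn (fun x => C * (Real.sqrt |x - x₀|)⁻¹) (Metric.ball x₀ (min δ 1)) :=
      ((integrableOn_inv_sqrt_abs_sub x₀).mono_set hsub).const_mul C
    refine Integrable.mono' hg hf_meas.aestronglyMeasurable ?_
    have hne : ∀ᵐ x ∂(volume.restrict (Metric.ball x₀ (min δ 1))), x ∉ ({x₀} : Set ℝ) :=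
      ae_restrict_of_ae (measure_eq_zero_iff_ae_notMem.mp (measure_singleton x₀))
    filter_upwards [ae_restrict_mem measurableSet_ball, hne] with x hx hxne
    rw [hf_norm]
    have hxδ : |x - x₀| < δ := by
      rw [← Real.dist_eq]; exact (Metric.mem_ball.mp hx).trans_le (min_le_left _ _)
    exact hC x hxδ hxne
  -- tails
  obtain ⟨R, hR, htop, hbot⟩ := W.twoTorsionPolynomial_bounds
  have hint : Integrable f := by
    refine hloc.integrable_of_isBigO_atBot_atTop (g := fun _ => (0 : ℝ))
      (g' := fun x => x ^ (-(3 / 2) : ℝ)) ?_ ?_ ?_ ?_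
    · refine isBigO_zero_right_iff.mpr ?_
      filter_upwards [eventually_le_atBot (-R)] with x hx
      simp only [hf, Pi.zero_apply]
      rw [Real.sqrt_eq_zero'.mpr (hbot x hx), inv_zero]
    · exact ⟨univ, univ_mem, integrableOn_zero⟩
    · refine IsBigO.of_bound' ?_
      filter_upwards [eventually_ge_atTop R] with x hx
      have hx0 : 0 < x := hR.trans_le hx
      have hx3 : 0 < x ^ 3 := by positivity
      rw [hf_norm, Real.norm_of_nonneg (Real.rpow_nonneg hx0.le _)]
      calc f x ≤ (Real.sqrt (x ^ 3))⁻¹ :=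
            inv_anti₀ (Real.sqrt_pos.mpr hx3) (Real.sqrt_le_sqrt (htop x hx))
        _ = x ^ (-(3 / 2) : ℝ) := by
            rw [Real.sqrt_eq_rpow, ← Real.rpow_natCast, ← Real.rpow_mul hx0.le,
              Real.rpow_neg hx0.le]
            norm_num
    · exact ⟨Ioi R, Ioi_mem_atTop R, integrableOn_Ioi_rpow_of_lt (by norm_num) hR⟩
  exact hint.integrableOn

/-- **Discharge of `integrableOn_inv_sqrt_twoTorsionPolynomial`.**
[cite: CremonaAlgorithms1997, §3.7 (3.7.1)] -/
theorem integrableOn_inv_sqrt_twoTorsionPolynomial_holds :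
    W.integrableOn_inv_sqrt_twoTorsionPolynomial := by
  intro hE
  exact W.integrableOn_inv_sqrt_twoTorsionPolynomial'

/-- **Positivity of the real period** (instance form of the named fact `realPeriod_pos`):
`0 < Ω(W) = 2 ∫_{ψ>0} dx/√ψ` for an elliptic curve `W` over `ℝ`, since the integrand is
integrable (`integrableOn_inv_sqrt_twoTorsionPolynomial'`) and strictly positive on the
non-empty open set `{ψ > 0}`, which has positive Lebesgue measure.  In Cremona's normalisation
`Ω = 2λ₁` (`Δ > 0`) resp. `λ₁` (`Δ < 0`) with `λ₁ = π/AGM(√(e₃−e₁), √(e₃−e₂)) > 0`.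
[cite: CremonaAlgorithms1997, §3.7 (3.7.1); Silverman AEC C.16] -/
theorem realPeriod_pos' [W.IsElliptic] : 0 < W.realPeriod := by
  unfold realPeriod
  refine mul_pos two_pos ?_
  rw [setIntegral_pos_iff_support_of_nonneg_ae
    (Eventually.of_forall fun x => inv_nonneg.mpr (Real.sqrt_nonneg _))
    W.integrableOn_inv_sqrt_twoTorsionPolynomial']
  have hsub : W.twoTorsionSet ⊆
      Function.support (fun x => (Real.sqrt (W.twoTorsionPolynomial.toPoly.eval x))⁻¹) ∩
        W.twoTorsionSet :=
    fun x hx => ⟨(inv_pos.mpr (Real.sqrt_pos.mpr hx)).ne', hx⟩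
  exact lt_of_lt_of_le (W.isOpen_twoTorsionSet.measure_pos volume W.twoTorsionSet_nonempty)
    (measure_mono hsub)

/-- **Discharge of `realPeriod_pos`**: the real period of an elliptic curve over `ℝ` is positive.
[cite: CremonaAlgorithms1997, §3.7 (3.7.1); Silverman AEC C.16] -/
theorem realPeriod_pos_holds : W.realPeriod_pos := by
  intro hE
  exact W.realPeriod_pos'

end RealPeriodPos

end WeierstrassCurve

end
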